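import Summits.ValiantsHypothesis.ValiantsHypothesis.Theorems.GrenetZeonDualUnipotentThreeHalvesHeavyTopHalfSpeed

/-!
# `GrenetZeon.DualUnipotentThreeHalves` (stmt-ValiantsHypothesis-24318), LINE β `half_speed`, stub K1
# `stub_halfSpeedLaw_of_irr` (L) — FIRST HONEST SUB-CASE: the SEAM STEP of the induction (transport + one seam)

K1 (`HalfSpeedIrrLaw → HalfSpeedLaw`, `Cruxes/DualUnipotentThreeHalves/Lines/half_speed.lean` @65fd08b4719a) is an induction
along a composition chain: block-triangularise the nilpotent space `U`, treat the irreducible constituents by C⁺ or kill them,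
and GLUE.  The gluing lemma ✓ `halfSpeed_glue` (port-4 g2, p‹HalfSpeed›) is stated for the full glue SETS
`glue U₁ U₂ = {[[A, *], [0, D]]}` over the index type `ι₁ ⊕ ι₂`.  The induction consumes it in three transported forms,
typed here (desk #328 (a): «carve and NAME the first honest sub-case»):

* `halfSpeed_of_blocks` — **the seam step for arbitrary subsets**: if every member of `U` (resp. `T`) is block-upper with
  diagonal blocks in `U₁, U₂` (resp. `T₁, T₂`), then `HalfSpeed Θ₁ U₁ T₁ → HalfSpeed Θ₂ U₂ T₂ → HalfSpeed (Θ₁+Θ₂+1) U T`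
  (`U ⊆ glue U₁ U₂` by `Matrix.fromBlocks_toBlocks`, then ✓ `halfSpeed_anti` + ✓ `halfSpeed_glue`) — this is the form
  the SUBMODULE induction uses (`U` a linear space of block-upper matrices is never the full glue set);
* `gword_reindex`, `halfSpeed_reindex` — **index transport** `ι ≃ κ` (so `ι₁ ⊕ ι₂` can be read back as `Fin (d₁ + d₂)`);
* `gword_conj`, `halfSpeed_conj`, `halfSpeed_of_conj` — **conjugation transport** by a mutually inverse pair `C, D`
  (so a composition chain's adapted basis can be used).

What is NOT here (the rest of K1, staged for the pool): the codimension bookkeeping `Θ·codim ≤ C·d²` across seams, the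
height allocation `Θ_t ∝ d_t`, the kill/certify packing, and the composition chain itself (✓ `HeavyTopCompositionBound.exists_block_conj`).
Honest framing: plumbing for a stub of LINE β; nothing here proves `HalfSpeedLaw`, `HalfSpeedIrrLaw`, `HeavyTopLaw`, 24318, S3b or
8062; `VP ≠ VNP` is not moved; no summit statement is proved here.  No definitions, no named facts. [β card; val-port-3 g2]
-/

noncomputable section

-- single-conjunct layout: Sub = Summit, duplicated namespace component intended
set_option linter.dupNamespace false

namespace Summit.ValiantsHypothesis.ValiantsHypothesis.Theorems.GrenetZeon.HalfSpeed

open Matrix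

/-! ## §1 The seam step for arbitrary block-upper subsets -/

section Seam

variable {ι₁ ι₂ : Type*} [Fintype ι₁] [Fintype ι₂] [DecidableEq ι₁] [DecidableEq ι₂]

omit [Fintype ι₁] [Fintype ι₂] [DecidableEq ι₁] [DecidableEq ι₂] in
/-- A block-upper matrix with prescribed diagonal blocks lies in the glue set. -/
theorem mem_glue_of_blocks (U₁ : Set (Matrix ι₁ ι₁ ℂ)) (U₂ : Set (Matrix ι₂ ι₂ ℂ))
    (A : Matrix (ι₁ ⊕ ι₂) (ι₁ ⊕ ι₂) ℂ) (h21 : A.toBlocks₂₁ = 0) (h11 : A.toBlocks₁₁ ∈ U₁) (h22 : A.toBlocks₂₂ ∈ U₂) :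
    A ∈ glue U₁ U₂ := by
  refine ⟨A.toBlocks₁₁, h11, A.toBlocks₂₂, h22, A.toBlocks₁₂, ?_⟩
  conv_lhs => rw [← Matrix.fromBlocks_toBlocks A]
  rw [h21]

/-- **SEAM STEP (subsets).**  If every member of `U` is block-upper with diagonal blocks in `U₁`, `U₂`, and every member
of `T` is block-upper with diagonal blocks in `T₁`, `T₂`, then half-speed profiles glue with one extra unit of height:
`HalfSpeed Θ₁ U₁ T₁ → HalfSpeed Θ₂ U₂ T₂ → HalfSpeed (Θ₁ + Θ₂ + 1) U T`. [β card K1, seam step; ✓ `halfSpeed_glue`] -/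
theorem halfSpeed_of_blocks (Θ₁ Θ₂ : ℕ) (U T : Set (Matrix (ι₁ ⊕ ι₂) (ι₁ ⊕ ι₂) ℂ))
    (U₁ T₁ : Set (Matrix ι₁ ι₁ ℂ)) (U₂ T₂ : Set (Matrix ι₂ ι₂ ℂ))
    (hU : ∀ A ∈ U, A.toBlocks₂₁ = 0 ∧ A.toBlocks₁₁ ∈ U₁ ∧ A.toBlocks₂₂ ∈ U₂)
    (hT : ∀ A ∈ T, A.toBlocks₂₁ = 0 ∧ A.toBlocks₁₁ ∈ T₁ ∧ A.toBlocks₂₂ ∈ T₂)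
    (h₁ : HalfSpeed Θ₁ U₁ T₁) (h₂ : HalfSpeed Θ₂ U₂ T₂) : HalfSpeed (Θ₁ + Θ₂ + 1) U T := by
  refine halfSpeed_anti (U := glue U₁ U₂) (T := glue T₁ T₂) ?_ ?_ (halfSpeed_glue Θ₁ Θ₂ U₁ T₁ U₂ T₂ h₁ h₂)
  · intro A hA
    obtain ⟨h21, h11, h22⟩ := hU A hA
    exact mem_glue_of_blocks U₁ U₂ A h21 h11 h22
  · intro A hA
    obtain ⟨h21, h11, h22⟩ := hT A hA
    exact mem_glue_of_blocks T₁ T₂ A h21 h11 h22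

/-- **SEAM STEP (linear spaces).**  For a linear space `U` of block-upper matrices whose diagonal blocks lie in the linear
spaces `U₁`, `U₂`, and subspaces `T₁`, `T₂` certifying them, the subspace
`T = {A ∈ U : A₁₁ ∈ T₁, A₂₂ ∈ T₂}` (given here as any `T ≤ U` with that property) is certified at height `Θ₁ + Θ₂ + 1`. -/
theorem halfSpeed_of_blocks_submodule (Θ₁ Θ₂ : ℕ) (U T : Submodule ℂ (Matrix (ι₁ ⊕ ι₂) (ι₁ ⊕ ι₂) ℂ))
    (U₁ T₁ : Submodule ℂ (Matrix ι₁ ι₁ ℂ)) (U₂ T₂ : Submodule ℂ (Matrix ι₂ ι₂ ℂ))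
    (hblock : ∀ A ∈ U, A.toBlocks₂₁ = 0) (hU₁ : ∀ A ∈ U, A.toBlocks₁₁ ∈ U₁) (hU₂ : ∀ A ∈ U, A.toBlocks₂₂ ∈ U₂)
    (hTU : T ≤ U) (hT₁ : ∀ A ∈ T, A.toBlocks₁₁ ∈ T₁) (hT₂ : ∀ A ∈ T, A.toBlocks₂₂ ∈ T₂)
    (h₁ : HalfSpeed Θ₁ (U₁ : Set (Matrix ι₁ ι₁ ℂ)) T₁) (h₂ : HalfSpeed Θ₂ (U₂ : Set (Matrix ι₂ ι₂ ℂ)) T₂) :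
    HalfSpeed (Θ₁ + Θ₂ + 1) (U : Set (Matrix (ι₁ ⊕ ι₂) (ι₁ ⊕ ι₂) ℂ)) T :=
  halfSpeed_of_blocks Θ₁ Θ₂ _ _ _ _ _ _ (fun A hA => ⟨hblock A hA, hU₁ A hA, hU₂ A hA⟩)
    (fun A hA => ⟨hblock A (hTU hA), hT₁ A hA, hT₂ A hA⟩) h₁ h₂

end Seam

/-! ## §2 Index transport -/

section Reindex

variable {ι κ : Type*} [Fintype ι] [Fintype κ] [DecidableEq ι] [DecidableEq κ]

/-- Words commute with reindexing. -/
theorem gword_reindex (e : ι ≃ κ) (P Q : Matrix ι ι ℂ) (w : List Bool) :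
    gword (Matrix.reindex e e P) (Matrix.reindex e e Q) w = Matrix.reindex e e (gword P Q w) := by
  induction w with
  | nil => simp [gword]
  | cons b w ih =>
      have hcons : ∀ (X Y : Matrix κ κ ℂ) , gword X Y (b :: w) = (if b then Y else X) * gword X Y w := by
        intro X Y; simp [gword]
      have hcons' : ∀ (X Y : Matrix ι ι ℂ) , gword X Y (b :: w) = (if b then Y else X) * gword X Y w := by
        intro X Y; simp [gword]
      rw [hcons, hcons', ih]
      cases b <;> simp

/-- **Index transport.**  `HalfSpeed` is invariant under reindexing both letters by a bijection `ι ≃ κ`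
(e.g. `ι₁ ⊕ ι₂ ≃ Fin (d₁ + d₂)` after a seam). -/
theorem halfSpeed_reindex (e : ι ≃ κ) (Θ : ℕ) (U T : Set (Matrix ι ι ℂ)) (h : HalfSpeed Θ U T) :
    HalfSpeed Θ ((Matrix.reindex e e) '' U) ((Matrix.reindex e e) '' T) := by
  rintro _ ⟨P, hP, rfl⟩ _ ⟨Q, hQ, rfl⟩ w hw
  refine h P hP Q hQ w ?_
  intro h0
  apply hw
  rw [gword_reindex, h0]
  simp

end Reindex

/-! ## §3 Conjugation transport -/

section Conj

variable {ι : Type*} [Fintype ι] [DecidableEq ι]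

/-- Words commute with conjugation by a mutually inverse pair `C, D` (`C D = D C = 1`). -/
theorem gword_conj (C D : Matrix ι ι ℂ) (hCD : C * D = 1) (hDC : D * C = 1) (P Q : Matrix ι ι ℂ) (w : List Bool) :
    gword (C * P * D) (C * Q * D) w = C * gword P Q w * D := by
  induction w with
  | nil => simp [gword, hCD]
  | cons b w ih =>
      have hcons : ∀ (X Y : Matrix ι ι ℂ), gword X Y (b :: w) = (if b then Y else X) * gword X Y w := by
        intro X Y; simp [gword]
      simp only [hcons, ih]
      cases b <;> simp only [Bool.false_eq_true, ↓reduceIte, Matrix.mul_assoc] <;>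
        rw [← Matrix.mul_assoc D C, hDC, Matrix.one_mul]

/-- **Conjugation transport.**  `HalfSpeed` is invariant under simultaneous conjugation `X ↦ C X D` (`C D = D C = 1`) of both
letter sets (so the adapted basis of a composition chain may be used). -/
theorem halfSpeed_conj (C D : Matrix ι ι ℂ) (hCD : C * D = 1) (hDC : D * C = 1) (Θ : ℕ) (U T : Set (Matrix ι ι ℂ))
    (h : HalfSpeed Θ U T) :
    HalfSpeed Θ ((fun X => C * X * D) '' U) ((fun X => C * X * D) '' T) := by
  rintro _ ⟨P, hP, rfl⟩ _ ⟨Q, hQ, rfl⟩ w hw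
  refine h P hP Q hQ w ?_
  intro h0
  apply hw
  show gword (C * P * D) (C * Q * D) w = 0
  rw [gword_conj C D hCD hDC, h0, Matrix.mul_zero, Matrix.zero_mul]

/-- Converse direction: a profile for the conjugated sets gives the profile for the original sets. -/
theorem halfSpeed_of_conj (C D : Matrix ι ι ℂ) (hCD : C * D = 1) (hDC : D * C = 1) (Θ : ℕ) (U T : Set (Matrix ι ι ℂ))
    (h : HalfSpeed Θ ((fun X => C * X * D) '' U) ((fun X => C * X * D) '' T)) :
    HalfSpeed Θ U T := by
  intro P hP Q hQ w hw
  refine h _ ⟨P, hP, rfl⟩ _ ⟨Q, hQ, rfl⟩ w ?_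
  intro h0
  apply hw
  have h0' : gword (C * P * D) (C * Q * D) w = 0 := h0
  rw [gword_conj C D hCD hDC] at h0'
  have := congrArg (fun X => D * X * C) h0'
  simp only [Matrix.mul_zero, Matrix.zero_mul] at this
  calc gword P Q w = (D * C) * gword P Q w * (D * C) := by rw [hDC, Matrix.one_mul, Matrix.mul_one]
    _ = D * (C * gword P Q w * D) * C := by simp only [Matrix.mul_assoc]
    _ = 0 := this

end Conj

end Summit.ValiantsHypothesis.ValiantsHypothesis.Theorems.GrenetZeon.HalfSpeed

end
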